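import Literature.Barriers.RiemannHypothesis.BerryKeatingOperator
import Literature.NumberTheory.LFunctions.ZetaArgVariation
import Mathlib.Analysis.SpecialFunctions.Pow.Asymptotics
import HarnessLib

/-!
# Barrier: the Riemann zeros are not the levels of a `D`-dimensional scaling system — no power-law (Weyl) counting function matches `N(T) ∼ (T/2π) log T` (Berry–Keating 1999, §6 (i); Weyl 1911)

Barrier catalogue `Literature/Barriers/RiemannHypothesis/` (D-0021), entry `ScalingSystemCounting`
(namespace `Literature.Barriers.RiemannHypothesis`; the catalogued declaration is
`ScalingSystemCounting`, PROVED unconditionally as `ScalingSystemCounting_holds` from the tree's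
theorem `Literature.NumberTheory.LFunctions.riemann_von_mangoldt_holds`).

This entry is the companion of `BerryKeatingOperator` (Endres–Steiner: `H = xp` on `L²(ℝ_>)`
and on compact quantum graphs, whose Weyl law is LINEAR): it records the general counting
constraint printed by Berry–Keating on any Hilbert–Pólya operator, and proves the comparison for
every POWER law.

## The technique (Hilbert–Pólya by a scaling quantum system; Berry–Keating 1999, §§2–3, §6)

Berry–Keating list the properties "the conjectured Riemann operator `H`" must have (§6 (a)–(j)),
derived from reading the Riemann–von Mangoldt formula and the explicit formula as a Gutzwiller
trace formula (§2). The semiclassical level count of a quantum Hamiltonian with `D` freedoms is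
(§2, text before (2.19)): "The smooth part `⟨N(E)⟩` of the counting function is, to leading order in `ħ`, the number
of phase space quantum cells (volume `h^D`) in the volume `Ω(E)` of the energy surface `H = E`;
thus `⟨N(E)⟩ ≈ Ω(E)/h^D`. For billiards, `Ω` is proportional to the spatial volume confining the
system (this is Weyl's asymptotics)." For the Laplacian on a compact domain `M ⊂ ℝ^m` (Dirichlet
conditions) or a compact Riemannian manifold, Weyl's asymptotic law reads
`λ_k^{m/2}(M) ∼ k c_m / vol M` (Buser (7.1.1); Minakshisundaram–Pleijel 1949 for manifolds),
i.e. `N(λ) ∼ (vol M / c_m) λ^{m/2}` — a pure power of the spectral parameter.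

## The obstruction (what this file vendors) — Berry–Keating §6 (i), PROVED

"(i) The Riemann dynamics is quasi-one-dimensional. There are two indications of this. First,
the number of zeros less than `t` increases as `t log t`; for a `D`-dimensional scaling system,
with energy parameter `α(E)` proportional to `1/ħ`, the number of energy levels increases as
`α(E)^D`." Formalised: a counting function `N` with a power law `N(α)/α^γ → C`, `C > 0`, `γ > 0`
(`HasPowerLawCounting N C γ`; `γ = D`, or `D/2` if levels rather than wave numbers are matched
with the heights `t`) is eventually different from the zeta zero count
`N_ζ(T) = #{ρ : 0 < Im ρ ≤ T}` (`Literature.NumberTheory.LFunctions.zetaZeroCount`, with multiplicity): for `γ ≤ 1`,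
`N_ζ(T)/T^γ → ∞` (`tendsto_zetaZeroCount_div_rpow_atTop`), and for `γ > 1`, `N_ζ(T)/T^γ → 0`
(`tendsto_zetaZeroCount_div_rpow_zero`), both from the Riemann–von Mangoldt formula
`N(T) = (T/2π) log(T/2π) − T/2π + O(log T)` (the tree's `Literature.NumberTheory.LFunctions.riemann_von_mangoldt`, discharged as
`Literature.NumberTheory.LFunctions.riemann_von_mangoldt_holds`). In particular `N_ζ` itself obeys no power law
(`not_hasPowerLawCounting_zetaZeroCount`), and no identification `t_n = α(E_n)` (or
`t_n² + ¼ = λ_n`, see the design notes) with the levels of such a system can hold from some point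
on (`ScalingSystemCounting_holds`, `ScalingSystemCounting.not_eventuallyEq`).

## References

* [BerryKeating1999SIAM] M. V. Berry, J. P. Keating, *The Riemann zeros and eigenvalue
  asymptotics*, SIAM Review 41 (1999), 236–266 (read: §2 with (2.1)–(2.20), in particular the text
  before (2.19), p. 243; §6 (a)–(j), p. 260, (6.1)–(6.2) and the text after (6.2), p. 261).
* [Buser2010] P. Buser, *Geometry and Spectra of Compact Riemann Surfaces*, Birkhäuser (1992,
  reprint 2010), §7.1 (7.1.1) (Weyl's asymptotic law for compact domains and, after
  Minakshisundaram–Pleijel, compact manifolds), Theorem 9.2.14 (`λ_n(M) ∼ 4πn / area M`) — read.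
* [EndresSteiner2010] S. Endres, F. Steiner, J. Phys. A 43 (2010) 095204 — the companion entry
  `BerryKeatingOperator` (linear Weyl laws on compact graphs), whose lemma
  `tendsto_zetaZeroCount_div_atTop` is reused.
* [Titchmarsh1986] Thm. 9.4 (Riemann–von Mangoldt), via `Literature.NumberTheory.LFunctions.riemann_von_mangoldt_holds`.

## Design notes

* `HasPowerLawCounting N C γ := 0 < C ∧ N(α)/α^γ → C` (any real exponent `γ`: Berry–Keating's
  `α(E)^D` has `γ = D ∈ ℕ`, Weyl's law for `m`-dimensional Laplacians `γ = m/2` in the eigenvalue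
  and `γ = m` in the wave number; the proofs need no sign condition on `γ`, so none is imposed).
* Matching eigenvalues `λ_n = ¼ + t_n²` (the `s(1 − s)` parametrisation of `PseudoLaplacianSpacing`)
  with a Weyl law `N(λ) ∼ cλ^{m/2}` means `#{t_n ≤ T} ∼ c′ T^m`, again a power law in `T`, so it is
  covered by the same statement (with `γ = m`); non-compact finite-area hyperbolic surfaces, whose
  Weyl law carries a `−(√λ/π) log √λ` term from the continuous spectrum, are NOT power-law and are
  outside this entry (they are the setting of `PseudoLaplacianSpacing`).
* The lemmas are stated with the Riemann–von Mangoldt fact as a hypothesis `(h :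
  Literature.riemann_von_mangoldt)` (as in `BerryKeatingOperator`) and then discharged with
  `Literature.NumberTheory.LFunctions.riemann_von_mangoldt_holds`, so the catalogued theorem is unconditional.
-/

noncomputable section

open Filter Asymptotics Topology

namespace Literature.Barriers.RiemannHypothesis

/-! ## Power-law counting functions -/

/-- **Power-law level counting** ("for a `D`-dimensional scaling system … the number of energy
levels increases as `α(E)^D`"; Weyl: `N(λ) ∼ (vol M/c_m) λ^{m/2}`): `N(α)/α^γ → C` with `C > 0`.
The printed exponents are `γ = D > 0` (or `m/2`); no sign condition on `γ` is imposed here, since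
the comparison below holds for every real exponent. [cite: BerryKeating1999SIAM, §6 (i) and §2 (text before (2.19))] [cite: Buser2010, §7.1 (7.1.1)] -/
def HasPowerLawCounting (N : ℝ → ℝ) (C γ : ℝ) : Prop :=
  0 < C ∧ Tendsto (fun α ↦ N α / α ^ γ) atTop (𝓝 C)

/-- A linear Weyl law with positive slope (`BerryKeatingOperator`'s `HasLinearWeylLaw N a`,
`a > 0`) is the power law `γ = 1`. [folklore] -/
theorem HasLinearWeylLaw.hasPowerLawCounting {N : ℝ → ℝ} {a : ℝ} (hN : HasLinearWeylLaw N a)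
    (ha : 0 < a) : HasPowerLawCounting N a 1 :=
  ⟨ha, by simpa [HasLinearWeylLaw, Real.rpow_one] using hN⟩

/-! ## The zeta zero count obeys no power law (from Riemann–von Mangoldt) -/

/-- The Riemann–von Mangoldt main term is `O(T log T)`. [folklore] -/
theorem vonMangoldtMain_isBigO_mul_log :
    (fun T : ℝ ↦ T / (2 * Real.pi) * Real.log (T / (2 * Real.pi)) - T / (2 * Real.pi))
      =O[atTop] fun T : ℝ ↦ T * Real.log T := by
  have h2π : 0 < 2 * Real.pi := by positivity
  have h1 : (fun T : ℝ ↦ T / (2 * Real.pi) * Real.log (T / (2 * Real.pi))) =O[atTop]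
      fun T : ℝ ↦ T * Real.log T := by
    refine IsBigO.of_bound 1 ?_
    filter_upwards [eventually_ge_atTop (2 * Real.pi), eventually_ge_atTop (1 : ℝ)] with T hT hT1
    have hTpos : 0 < T := lt_of_lt_of_le h2π hT
    have hlogT : 0 ≤ Real.log T := Real.log_nonneg hT1
    have hlog1 : 0 ≤ Real.log (T / (2 * Real.pi)) := Real.log_nonneg ((one_le_div h2π).2 hT)
    have hlog2 : Real.log (T / (2 * Real.pi)) ≤ Real.log T :=
      Real.log_le_log (div_pos hTpos h2π) (div_le_self hTpos.le (by linarith [Real.pi_gt_three]))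
    rw [one_mul, Real.norm_of_nonneg (mul_nonneg (div_nonneg hTpos.le h2π.le) hlog1),
      Real.norm_of_nonneg (mul_nonneg hTpos.le hlogT)]
    have : T / (2 * Real.pi) ≤ T := div_le_self hTpos.le (by linarith [Real.pi_gt_three])
    exact mul_le_mul this hlog2 hlog1 hTpos.le
  have h2 : (fun T : ℝ ↦ T / (2 * Real.pi)) =O[atTop] fun T : ℝ ↦ T * Real.log T := by
    refine IsBigO.of_bound 1 ?_
    filter_upwards [eventually_ge_atTop (Real.exp 1), eventually_gt_atTop (0 : ℝ)] with T hT hT0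
    have hlog : 1 ≤ Real.log T := by
      rw [← Real.log_exp 1]; exact Real.log_le_log (Real.exp_pos 1) hT
    rw [one_mul, Real.norm_of_nonneg (div_nonneg hT0.le h2π.le),
      Real.norm_of_nonneg (mul_nonneg hT0.le (by linarith))]
    calc T / (2 * Real.pi) ≤ T := div_le_self hT0.le (by linarith [Real.pi_gt_three])
      _ = T * 1 := (mul_one T).symm
      _ ≤ T * Real.log T := mul_le_mul_of_nonneg_left hlog hT0.le
  exact h1.sub h2

/-- `T log T = o(T^γ)` for `γ > 1`. [folklore] -/
theorem mul_log_isLittleO_rpow {γ : ℝ} (hγ : 1 < γ) :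
    (fun T : ℝ ↦ T * Real.log T) =o[atTop] fun T : ℝ ↦ T ^ γ := by
  have h := (isLittleO_log_rpow_atTop (by linarith : 0 < γ - 1))
  have : (fun T : ℝ ↦ T ^ γ) =ᶠ[atTop] fun T : ℝ ↦ T * T ^ (γ - 1) := by
    filter_upwards [eventually_gt_atTop (0 : ℝ)] with T hT
    rw [← Real.rpow_one_add' hT.le (by linarith), add_sub_cancel]
  exact ((isBigO_refl (fun T : ℝ ↦ T) atTop).mul_isLittleO h).congr' EventuallyEq.rfl this.symm

/-- For `γ > 1`: `N_ζ(T)/T^γ → 0` (Riemann–von Mangoldt: `N_ζ(T) = O(T log T) = o(T^γ)`).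
[cite: BerryKeating1999SIAM, §6 (i)] -/
theorem tendsto_zetaZeroCount_div_rpow_zero (h : Literature.NumberTheory.LFunctions.riemann_von_mangoldt) {γ : ℝ} (hγ : 1 < γ) :
    Tendsto (fun T : ℝ ↦ (Literature.NumberTheory.LFunctions.zetaZeroCount T : ℝ) / T ^ γ) atTop (𝓝 0) := by
  have herr : (fun T : ℝ ↦ (Literature.NumberTheory.LFunctions.zetaZeroCount T : ℝ) -
      (T / (2 * Real.pi) * Real.log (T / (2 * Real.pi)) - T / (2 * Real.pi))) =o[atTop]
      fun T : ℝ ↦ T ^ γ :=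
    h.trans_isLittleO (isLittleO_log_rpow_atTop (by linarith))
  have hmain : (fun T : ℝ ↦ T / (2 * Real.pi) * Real.log (T / (2 * Real.pi)) - T / (2 * Real.pi))
      =o[atTop] fun T : ℝ ↦ T ^ γ :=
    vonMangoldtMain_isBigO_mul_log.trans_isLittleO (mul_log_isLittleO_rpow hγ)
  refine ((herr.add hmain).tendsto_div_nhds_zero).congr' ?_
  filter_upwards with T
  ring_nf

/-- For `γ ≤ 1`: `N_ζ(T)/T^γ → ∞` (since `N_ζ(T)/T → ∞`, `BerryKeatingOperator`'s
`tendsto_zetaZeroCount_div_atTop`, and `T^γ ≤ T` for `T ≥ 1`). [cite: BerryKeating1999SIAM, §6 (i)] -/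
theorem tendsto_zetaZeroCount_div_rpow_atTop (h : Literature.NumberTheory.LFunctions.riemann_von_mangoldt) {γ : ℝ}
    (hγ1 : γ ≤ 1) :
    Tendsto (fun T : ℝ ↦ (Literature.NumberTheory.LFunctions.zetaZeroCount T : ℝ) / T ^ γ) atTop atTop := by
  refine tendsto_atTop_mono' atTop ?_ (tendsto_zetaZeroCount_div_atTop h)
  filter_upwards [eventually_ge_atTop (1 : ℝ)] with T hT
  have hTpos : 0 < T := by linarith
  have hpow : T ^ γ ≤ T := by
    calc T ^ γ ≤ T ^ (1 : ℝ) := Real.rpow_le_rpow_of_exponent_le hT hγ1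
      _ = T := Real.rpow_one T
  exact div_le_div_of_nonneg_left (Nat.cast_nonneg _) (Real.rpow_pos_of_pos hTpos γ) hpow

/-- **`N_ζ` obeys no power law** ("the number of zeros less than `t` increases as `t log t`", not as
any `α^D`). [cite: BerryKeating1999SIAM, §6 (i)] -/
theorem not_hasPowerLawCounting_zetaZeroCount (h : Literature.NumberTheory.LFunctions.riemann_von_mangoldt) (C γ : ℝ) :
    ¬ HasPowerLawCounting (fun T ↦ (Literature.NumberTheory.LFunctions.zetaZeroCount T : ℝ)) C γ := by
  rintro ⟨hC, hlim⟩
  rcases le_or_gt γ 1 with hle | hlt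
  · exact not_tendsto_nhds_of_tendsto_atTop (tendsto_zetaZeroCount_div_rpow_atTop h hle) C hlim
  · exact hC.ne' (tendsto_nhds_unique hlim (tendsto_zetaZeroCount_div_rpow_zero h hlt))

/-- **Slow growth (`γ ≤ 1`): a power-law count is eventually strictly BELOW `N_ζ`.**
[cite: BerryKeating1999SIAM, §6 (i)] -/
theorem eventually_lt_zetaZeroCount_of_hasPowerLawCounting (h : Literature.NumberTheory.LFunctions.riemann_von_mangoldt)
    {N : ℝ → ℝ} {C γ : ℝ} (hN : HasPowerLawCounting N C γ) (hγ : γ ≤ 1) :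
    ∀ᶠ T in atTop, N T < Literature.NumberTheory.LFunctions.zetaZeroCount T := by
  obtain ⟨hC, hlim⟩ := hN
  have h1 : ∀ᶠ T in atTop, N T / T ^ γ < C + 1 := hlim.eventually (eventually_lt_nhds (by linarith))
  have h2 : ∀ᶠ T in atTop, C + 1 < (Literature.NumberTheory.LFunctions.zetaZeroCount T : ℝ) / T ^ γ :=
    (tendsto_zetaZeroCount_div_rpow_atTop h hγ).eventually_gt_atTop (C + 1)
  filter_upwards [h1, h2, eventually_gt_atTop (0 : ℝ)] with T hT1 hT2 hT
  have := hT1.trans hT2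
  rwa [div_lt_div_iff_of_pos_right (Real.rpow_pos_of_pos hT γ)] at this

/-- **Fast growth (`γ > 1`): a power-law count is eventually strictly ABOVE `N_ζ`.**
[cite: BerryKeating1999SIAM, §6 (i)] -/
theorem eventually_zetaZeroCount_lt_of_hasPowerLawCounting (h : Literature.NumberTheory.LFunctions.riemann_von_mangoldt)
    {N : ℝ → ℝ} {C γ : ℝ} (hN : HasPowerLawCounting N C γ) (hγ : 1 < γ) :
    ∀ᶠ T in atTop, (Literature.NumberTheory.LFunctions.zetaZeroCount T : ℝ) < N T := by
  obtain ⟨hC, hlim⟩ := hN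
  have h1 : ∀ᶠ T in atTop, C / 2 < N T / T ^ γ := hlim.eventually (eventually_gt_nhds (by linarith))
  have h2 : ∀ᶠ T in atTop, (Literature.NumberTheory.LFunctions.zetaZeroCount T : ℝ) / T ^ γ < C / 2 :=
    (tendsto_zetaZeroCount_div_rpow_zero h hγ).eventually (eventually_lt_nhds (by linarith))
  filter_upwards [h1, h2, eventually_gt_atTop (0 : ℝ)] with T hT1 hT2 hT
  have := hT2.trans hT1
  rwa [div_lt_div_iff_of_pos_right (Real.rpow_pos_of_pos hT γ)] at this

/-- **The comparison, proved.** A counting function with a power law `N(α) ∼ C α^γ` differs from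
`N_ζ` for all large `T` (below it if `γ ≤ 1`, above it if `γ > 1`, by the two previous lemmas).
[cite: BerryKeating1999SIAM, §6 (i)] -/
theorem eventually_ne_zetaZeroCount_of_hasPowerLawCounting (h : Literature.NumberTheory.LFunctions.riemann_von_mangoldt)
    {N : ℝ → ℝ} {C γ : ℝ} (hN : HasPowerLawCounting N C γ) :
    ∀ᶠ T in atTop, N T ≠ Literature.NumberTheory.LFunctions.zetaZeroCount T := by
  rcases le_or_gt γ 1 with hle | hlt
  · filter_upwards [eventually_lt_zetaZeroCount_of_hasPowerLawCounting h hN hle] with T hT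
    exact hT.ne
  · filter_upwards [eventually_zetaZeroCount_lt_of_hasPowerLawCounting h hN hlt] with T hT
    exact hT.ne'

/-! ## The barrier -/

/-- **Barrier `ScalingSystemCounting`** (PROVED, unconditionally: `ScalingSystemCounting_holds`).
Berry–Keating §6 (i): the heights `t` of the zeros cannot be the energy parameters of a
`D`-dimensional scaling quantum system — "the number of zeros less than `t` increases as `t log t`;
for a `D`-dimensional scaling system, with energy parameter `α(E)` proportional to `1/ħ`, the
number of energy levels increases as `α(E)^D`" — and more generally cannot be counted by any power
law `N(α) ∼ Cα^γ` (`C > 0`, any real `γ`): such an `N` differs from `N_ζ` for all large `T` (it is eventually below `N_ζ` if `γ ≤ 1`,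
`eventually_lt_zetaZeroCount_of_hasPowerLawCounting`, and eventually above if `γ > 1`,
`eventually_zetaZeroCount_lt_of_hasPowerLawCounting`), and `N_ζ` itself obeys no power law
(`ScalingSystemCounting.zetaZeroCount_not_powerLaw`).

BARRIER (structured block, D-0021):
- technique_class: Hilbert-Polya spectral-realisation-of-zeros zeros-as-eigenvalues Hilbert-Polya-by-scaling-quantum-system quantum-billiards Laplacian-on-compact-domain Laplace-Beltrami-compact-manifold D-freedom-semiclassical-Hamiltonian Weyl-law Weyl-law-mismatch power-law-level-counting Gutzwiller-trace-formula-analogy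
- blocks: realising the zero heights `t_n` (counting function `Literature.NumberTheory.LFunctions.zetaZeroCount`, i.e. the spectral side of `Literature.Analysis.UnboundedOperators.HilbertPolyaConjecture`) as the energy parameters `α(E_n)` of a `D`-dimensional scaling system, whose level count grows as `α(E)^D` [cite: BerryKeating1999SIAM, §6 (i) and §2 (text before (2.19))], in particular as eigenvalues or wave numbers of the (Dirichlet) Laplacian on a compact Euclidean domain or the Laplace–Beltrami operator of a compact Riemannian manifold, `N(λ) ∼ (vol M/c_m) λ^{m/2}` [cite: Buser2010, §7.1 (7.1.1)] — or of anything else with a power-law counting function `N(α) ∼ Cα^γ`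
- because: `N_ζ(T) = (T/2π) log(T/2π) − T/2π + O(log T)` (Riemann–von Mangoldt, tree theorem `Literature.NumberTheory.LFunctions.riemann_von_mangoldt_holds`) [cite: Titchmarsh1986, Thm. 9.4], so `N_ζ(T)/T^γ → ∞` for `γ ≤ 1` and `→ 0` for `γ > 1` (`tendsto_zetaZeroCount_div_rpow_atTop`, `tendsto_zetaZeroCount_div_rpow_zero`): a power law is eventually strictly below or strictly above `N_ζ` (`eventually_ne_zetaZeroCount_of_hasPowerLawCounting`) — "The Riemann dynamics is quasi-one-dimensional" [cite: BerryKeating1999SIAM, §6 (i)]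
- evasions_known: one-freedom Hamiltonians with a logarithmically growing phase-space area, the Berry–Keating `H_cl = XP` (6.1)–(6.2), with `⟨N(E)⟩ = (E/2π)(log(E/2π) − 1) + 7/8` after regularisation [cite: BerryKeating1999SIAM, §6 (6.1)–(6.2) and the text after (6.2) (referring to (2.3))] — whose standard quantisations are in turn blocked (entry `BerryKeatingOperator`) [cite: EndresSteiner2010, Thm. 15.6] — but NOT its modified self-adjoint quantisations `x(p + ℓ_p²/p)` (`x ≥ ℓ_x`) and `(x + ℓ_x²/x)(p + ℓ_p²/p)`, which have discrete spectrum with the full density `n(E) ≃ (E/2π)(log(E/2π) − 1) + O(1)` for `ℓ_xℓ_p = 2π` and so evade both density entries; they meet instead the fluctuation entry `BoundedFluctuationCounting` (`S(T)` unbounded, Selberg) [cite: SierraRodriguezLaguna2011, abstract and p. 4] [cite: Sierra2019, §5 (42)–(49)]; operators on NON-compact arithmetic quotients, where the continuous spectrum contributes `t log t`-size terms to the counting function (entry `PseudoLaplacianSpacing`, Bombieri–Garrett) — not power-law, hence outside this entry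
- scope_caveats: only the leading-order counting function is compared: the entry says nothing about operators whose level count is not asymptotic to a pure power (logarithmic corrections, non-compact or singular settings), nothing about matching a SUBSEQUENCE of levels with the zeros, and nothing about Hilbert–Pólya in general (`Literature.Analysis.UnboundedOperators.HilbertPolyaConjecture`); Berry–Keating's further constraints (b)–(h) (chaoticity, absence of time-reversal symmetry from GUE statistics, periods `log p`, Maslov phases `π`) rest on the conjectural random-matrix/semiclassical dictionary and are NOT vendored [cite: BerryKeating1999SIAM, §6 (a)–(j)]
- status: established (theorem; PROVED here)

[cite: BerryKeating1999SIAM, §6 (i)] [cite: Buser2010, §7.1 (7.1.1)] -/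
def ScalingSystemCounting : Prop :=
  ∀ (N : ℝ → ℝ) (C γ : ℝ), HasPowerLawCounting N C γ →
    ∀ᶠ T in atTop, N T ≠ Literature.NumberTheory.LFunctions.zetaZeroCount T

/-- The barrier from the Riemann–von Mangoldt fact. [cite: BerryKeating1999SIAM, §6 (i)] -/
theorem ScalingSystemCounting_of_riemann_von_mangoldt (h : Literature.NumberTheory.LFunctions.riemann_von_mangoldt) :
    ScalingSystemCounting :=
  fun _N _C _γ hN ↦ eventually_ne_zetaZeroCount_of_hasPowerLawCounting h hN

/-- **The barrier holds unconditionally** (the Riemann–von Mangoldt formula is the tree's theorem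
`Literature.NumberTheory.LFunctions.riemann_von_mangoldt_holds`). [cite: BerryKeating1999SIAM, §6 (i)] [cite: Titchmarsh1986, Thm. 9.4] -/
theorem ScalingSystemCounting_holds : ScalingSystemCounting :=
  ScalingSystemCounting_of_riemann_von_mangoldt Literature.NumberTheory.LFunctions.riemann_von_mangoldt_holds

/-- Consequence: a power-law counting function does not agree with `N_ζ` from any point on.
[cite: BerryKeating1999SIAM, §6 (i)] -/
theorem ScalingSystemCounting.not_eventuallyEq (hS : ScalingSystemCounting) {N : ℝ → ℝ} {C γ : ℝ}
    (hN : HasPowerLawCounting N C γ) : ¬ ∀ᶠ T in atTop, N T = Literature.NumberTheory.LFunctions.zetaZeroCount T := by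
  intro hEq
  obtain ⟨T, hne, heq⟩ := ((hS N C γ hN).and hEq).exists
  exact hne heq

/-- Consequence: `N_ζ` obeys no power law `N_ζ(T) ∼ C T^γ`, unconditionally.
[cite: BerryKeating1999SIAM, §6 (i)] -/
theorem ScalingSystemCounting.zetaZeroCount_not_powerLaw (C γ : ℝ) :
    ¬ HasPowerLawCounting (fun T ↦ (Literature.NumberTheory.LFunctions.zetaZeroCount T : ℝ)) C γ :=
  not_hasPowerLawCounting_zetaZeroCount Literature.NumberTheory.LFunctions.riemann_von_mangoldt_holds C γ

/-- In particular the linear case of `BerryKeatingOperator` (ii) with positive slope is an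
instance (`γ = 1`). [cite: EndresSteiner2010, Thm. 15.6] -/
theorem ScalingSystemCounting.linear (hS : ScalingSystemCounting) {N : ℝ → ℝ} {a : ℝ}
    (hN : HasLinearWeylLaw N a) (ha : 0 < a) : ∀ᶠ T in atTop, N T ≠ Literature.NumberTheory.LFunctions.zetaZeroCount T :=
  hS N a 1 (hN.hasPowerLawCounting ha)

end Literature.Barriers.RiemannHypothesis
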